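import Mathlib

/-!
# PercRepro — `e`-FREE POINT SETS IN A VECTOR SPACE HAVE AT MOST `C(r + 1, 2)` POINTS (the polynomial method; p1, gen 45)

proofs/P1-EFREE.md §2. A finite set `P` of vectors in an `r`-dimensional space `V` over a field `F` is `e`-FREE if every
`p ∈ P` has two linear functionals `φ, ψ` with `φ p ≠ 0 ≠ ψ p` such that every other point of `P` lies in `ker φ ∪ ker ψ`
— for the vector matroid on `P` this is exactly the cell's `hfree` («`P ∖ {p}` is covered by two hyperplanes avoiding `p`»,
i.e. `p` is the intersection of two cocircuits). THEOREM: **`|P| ≤ C(r + 1, 2)`**, with `K_{r+1}` (the vectors `e_u + e_v`)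
showing the bound is sharp. Proof: the quadratic forms `g_p = φ · ψ` satisfy `g_p(p) ≠ 0` and `g_p = 0` on `P ∖ {p}`, so they
are linearly independent as functions on `V`, and they all lie in the span of the `C(r + 1, 2)` products `x_i x_j` of the
coordinate functionals of a basis (indexed by `Sym2 (Fin r)`).

* `apply_eq_sum_coord` — a functional is its coordinate expansion; `mul_mem_span_coord_mul` — a product of two functionals
  lies in the span of the coordinate products (indexed by pairs);
* **`card_le_choose_of_free`** — the bound; `card_le_of_free` — the form `|P| ≤ r (r + 1) / 2`.
This is a statement about representable matroids only; the cell's general flat bounds (`f(5) ≤ 19`, …) are untouched.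
Axioms: standard.
-/

namespace PercRepro

namespace EFree

open Module Finset

variable {F : Type} [Field F] {V : Type} [AddCommGroup V] [Module F V]

/-- A linear functional is the coordinate expansion `φ x = ∑ i, coord i x * φ (b i)`. -/
theorem apply_eq_sum_coord {n : ℕ} (b : Basis (Fin n) F V) (φ : V →ₗ[F] F) (x : V) :
    φ x = ∑ i, b.coord i x * φ (b i) := by
  conv_lhs => rw [← b.sum_repr x]
  simp only [map_sum, map_smul, Basis.coord_apply, smul_eq_mul]

/-- The product of two linear functionals lies in the span of the products `x ↦ coord i x * coord j x` (over all pairs). -/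
theorem mul_mem_span_coord_mul {n : ℕ} (b : Basis (Fin n) F V) (φ ψ : V →ₗ[F] F) :
    (fun x => φ x * ψ x) ∈
      Submodule.span F (Set.range (fun ij : Fin n × Fin n => fun x => b.coord ij.1 x * b.coord ij.2 x)) := by
  have hfun : (fun x => φ x * ψ x) =
      ∑ i, ∑ j, (φ (b i) * ψ (b j)) • (fun x => b.coord i x * b.coord j x) := by
    funext x
    simp only [Finset.sum_apply, Pi.smul_apply, smul_eq_mul]
    rw [apply_eq_sum_coord b φ x, apply_eq_sum_coord b ψ x, Finset.sum_mul_sum]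
    refine Finset.sum_congr rfl fun i _ => Finset.sum_congr rfl fun j _ => ?_
    ring
  rw [hfun]
  exact Submodule.sum_mem _ fun i _ => Submodule.sum_mem _ fun j _ =>
    Submodule.smul_mem _ _ (Submodule.subset_span ⟨(i, j), rfl⟩)

/-- **THE BOUND**: an `e`-free finite set `P` in a finite-dimensional space of dimension `r` has at most `C(r + 1, 2)` points. -/
theorem card_le_choose_of_free [FiniteDimensional F V] (P : Finset V)
    (h : ∀ p ∈ P, ∃ φ ψ : V →ₗ[F] F, φ p ≠ 0 ∧ ψ p ≠ 0 ∧ ∀ x ∈ P, x ≠ p → φ x = 0 ∨ ψ x = 0) :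
    P.card ≤ Nat.choose (finrank F V + 1) 2 := by
  classical
  choose! φ ψ hφ hψ hsep using h
  let b := Module.finBasis F V
  -- the symmetric coordinate products, indexed by `Sym2`
  let sp : Sym2 (Fin (finrank F V)) → (V → F) :=
    Sym2.lift ⟨fun i j => fun x => b.coord i x * b.coord j x, fun i j => by funext x; exact mul_comm _ _⟩
  let W : Submodule F (V → F) := Submodule.span F (Set.range sp)
  haveI : Module.Finite F W := Module.Finite.span_of_finite F (Set.finite_range _)
  have hpairs : Set.range (fun ij : Fin (finrank F V) × Fin (finrank F V) =>
      fun x => b.coord ij.1 x * b.coord ij.2 x) ⊆ Set.range sp := by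
    rintro _ ⟨⟨i, j⟩, rfl⟩
    exact ⟨s(i, j), Sym2.lift_mk _ i j⟩
  let g : P → (V → F) := fun p => fun x => φ p x * ψ p x
  have hgW : ∀ p : P, g p ∈ W := fun p => Submodule.span_mono hpairs (mul_mem_span_coord_mul b _ _)
  let g' : P → W := fun p => ⟨g p, hgW p⟩
  have hli : LinearIndependent F g' := by
    apply LinearIndependent.of_comp W.subtype
    rw [linearIndependent_iff']
    intro s c hsum p hp
    have hev : ∑ x ∈ s, c x * (φ x (p : V) * ψ x (p : V)) = 0 := by
      have := congrFun hsum (p : V)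
      simpa only [Finset.sum_apply, Pi.smul_apply, Function.comp_apply, Submodule.subtype_apply, smul_eq_mul,
        Pi.zero_apply] using this
    rw [Finset.sum_eq_single p] at hev
    · exact (mul_eq_zero.1 hev).resolve_right (mul_ne_zero (hφ p p.2) (hψ p p.2))
    · intro q _ hqp
      have hq : (p : V) ≠ q := fun hq => hqp (Subtype.ext hq.symm)
      rcases hsep q q.2 p p.2 hq with h0 | h0 <;> simp [h0]
    · intro hps
      exact absurd hp hps
  have h1 := hli.fintype_card_le_finrank
  calc P.card = Fintype.card P := (Fintype.card_coe P).symm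
    _ ≤ finrank F W := h1
    _ ≤ Fintype.card (Sym2 (Fin (finrank F V))) := finrank_range_le_card sp
    _ = Nat.choose (finrank F V + 1) 2 := by rw [Sym2.card, Fintype.card_fin]

/-- The same bound written as `r (r + 1) / 2`. -/
theorem card_le_of_free [FiniteDimensional F V] (P : Finset V)
    (h : ∀ p ∈ P, ∃ φ ψ : V →ₗ[F] F, φ p ≠ 0 ∧ ψ p ≠ 0 ∧ ∀ x ∈ P, x ≠ p → φ x = 0 ∨ ψ x = 0) :
    P.card ≤ finrank F V * (finrank F V + 1) / 2 := by
  have := card_le_choose_of_free P h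
  rwa [Nat.choose_two_right, Nat.add_sub_cancel, mul_comm] at this

end EFree

end PercRepro
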